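import Summits.QuantumFields.BalabanUV.Beta.SpineRecursiveW
import Summits.QuantumFields.BalabanUV.Beta.GAN24.BorderGaugeLegContact
import Summits.QuantumFields.BalabanUV.Beta.GAN24.GaugeReadChargeDipole
import Summits.QuantumFields.BalabanUV.Beta.KernelWardResidual

/-!
# `BalabanUV.Beta.GAN24.CombSlotDerivativeBorderRead` — binder row G-an2-4 ∕ (CONV-C), CT-W «WC-TL» → «QR-LL», the (S) row of RULING R-gan24p1-g27-1, the plain
# sub-row (T-F) of (W-γ): **THE MULTIPLIER-ROW ∕ FIELD-COLUMN BLOCK OF THE SLOT DERIVATIVE `dM K Lc S_j M1_j ν y′` IS THE VH BORDER ONLY, AND ITS PAIRING WITH THE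
# BLOCK PURE GAUGE `ĝ_y` IS leaf-02's BORDER `dψ`-LAW** (road-P2 chair `b2b-balaban-gan24-p2`, gen 40, INTENT 2; ingredient (a) of the (T-F) assembly)

NOT IN PRINT; OUR BOOKKEEPING ([folklore] block bookkeeping over an2's `SecondOrderResponse.dM ∕ vertexOfK ∕ vertexOfM`, the rooted tables `SpineRooted.SpureRecAt ∕ M1At`
(`ValueJetGeneric.e3OfK` = an `mmRead`, `StepJetData.wilsonA` and an1's `hessFFAt` vanish on the `(inr, inl)` block; only `(cVH·wVH_j) • vhSAt ρ` survives), one Fubini on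
`Site × Site` with leaf-06 g44's majorant `GaugeReadChargeDipole.summable_shifted_majorant`, and leaf-02 g47's `BorderGaugeLegContact.tsum_vhSAt_mul_dz` BY NAME; 0 `def`,
0 cited fact, 0 `def … : Prop`, 0 sorry).  HONEST FRAMING (cell contract, verbatim): «discharging `BetaPertH` makes Bałaban's UV stability UNCONDITIONAL — a real constructive-QFT
result; it is NOT the continuum limit and NOT the Clay problem.»  HONEST DEPENDENCY (verbatim): «continuum YM on T⁴ ⇐ BetaPertH ∧ nine spine estimates (0/9 proved); BetaPertH ⇐ (D1) ∧
(D4) ∧ CAP+tail; G-an2-4 gates asym, D1 and NE2/3/4.»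

WHAT (`d + 1` dimensions, blocking `Lc ≥ 1`, in-block root `ρ = toSite r`; tables `S_j = SpureRecAt d Lc ρ cE cVH cΛ j`, `M1_j = M1At d Lc ρ cΛ j`; ANY kernel `K` for §1–§2, a DECAYING
`K` for §3; slot `(ν, y′)`, label `y`, multiplier leg `(μ, p)`, field leg `(κ₂, x)`).
* §1 `SpureRecAt_inr_inl` (`S_j κ′ u′ p x (inr μ) (inl κ₂) = (cVH·wVH d Lc j)·vhSAt ρ κ′ u′ p x (inr μ) (inl κ₂)` — level `0`: `wilsonA` is field–field; level `j+1`: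
  `e3OfK = −mmRead` is field–field), `M1At_inr` (`M1_j ρ′ w p x (inr μ) b = 0`, an1's `hessFFAt_inr`).
* §2 **`dM_inr_inl`**: `(dM K Lc S_j M1_j ν y′) p x (inr μ) (inl κ₂) = (cVH·wVH d Lc j)·Σ_κ′ Σ'_u′ colH K Lc ν y′ κ′ u′ · vhSAt ρ κ′ u′ p x (inr μ) (inl κ₂)` — the
  multiplier-row ∕ field-column block of the slot derivative is the `ℋ`-column-weighted VH BORDER and nothing else.
* §3 `gaugeWt_eq_dz` (`ĝ_y = dz 1_{B(y)}`), the Fubini `tsum_sum_tsum_mul_mul_eq` (decaying weight × border entries × bounded test form), and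
  **`tsum_dM_inr_inl_mul_gaugeWt`**: for a decaying `K`,
  `Σ'_x Σ_κ₂ (dM K Lc S_j M1_j ν y′) p x (inr μ) (inl κ₂)·gaugeWt Lc y κ₂ x = (cVH·wVH d Lc j)·Σ_κ′ Σ'_u′ colH K Lc ν y′ κ′ u′·((1_{B(y)}(u′ + e_κ′) − 1_{B(y)}(p + ρ + Lc·e_μ))·linSymAt ρ Lc p u′ (inr μ) (inl κ′))`
  — leaf-02 g47's border `dψ`-law at `ψ = 1_{B(y)}`: the pure-gauge fluctuation returns the packed FIRST-ORDER kernel `q¹,ρ_{(μ, p∕Lc)}(κ′, u′)` weighted by «tip of the background bond in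
  `B(y)`» minus «far endpoint of the coarse bond in `B(y)`».  CONSUMER: the (T-F) assembly (INTENT 3), with leaf-06 g45's `GaugeReadColumnSums.colSum_combResponse_eq_multRows`.
* §4 bricks for that assembly: `abs_tsum_apply_le` (column sums of a decaying kernel are bounded by `CK·Zl δK`), the Fubini `tsum_sum_tsum_sum_mul_mul_eq` (bounded row weights ×
  bi-localised kernel × bounded test form), `tsum_coarse_of_off` (a lattice sum supported on the coarse points `Lc•ℤ^{d+1}` is a coarse sum).
Asserts NO value of Bałaban's tables beyond their typed block structure; discharges NOTHING of (S) ∕ (Q-R) ∕ (LT) ∕ (Q-L) ∕ (C) ∕ «T2Shape» ∕ «T2Drift» ∕ (hW, hWall); NEVER «G-an2-4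
closed» as (CONV-C); NOT D1, NOT BetaPertH, NOT continuum, NOT Clay.  2026-08-22; no existing file touched.
-/

noncomputable section

open Finset
open scoped BigOperators
open Literature.MathematicalPhysics.QuantumFieldTheory
open Literature.MathematicalPhysics.QuantumFieldTheory.Balaban1983to89
open Literature.MathematicalPhysics.QuantumFieldTheory.Balaban1983to89.Beta
open B12Sec2to5 (l1 l1_nonneg)
open ExpKernelCalculus (Site MKer Decays BiLoc Zl summable_exp_shift' tsum_exp_shift')
open AffineAveraging (box toSite dz)
open AveragingContours (blk off)
open AveragingHessianKernels (eq_smul_blk_of_off_eq_zero)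
open AxialProjector (blk_zsmul)
open AveragingHessianKernelsRooted (vhSAt locStencil_vhSAt hessFFAt_inr)
open AveragingWardStencils (b6UnitVec_eq)
open OneStepResolventKernel (Fib wsum LocStencil)
open OneStepKernelFamily (colH vertexOfK abs_colH_le)
open SecondOrderResponse (dM vertexOfM colM)
open InterLevelTransport (cwsum cwsum_apply)
open BalabanStepJetsSucc (wVH mmRead)
open StepJetData (wilsonA)
open Summit.QuantumFields.BalabanUV.Beta.SpineRooted (e3OfK_apply)
open Summit.QuantumFields.BalabanUV.Beta.SpineRooted (SpureRecAt M1At SpureRecAt_zero_level SpureRecAt_succ)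
open Summit.QuantumFields.BalabanUV.Beta.AveragingWardRootedStencils (linSymAt)
open Summit.QuantumFields.BalabanUV.Beta.KernelWardRelative (gaugeWt)
open Summit.QuantumFields.BalabanUV.Beta.KernelWardResidual (abs_gaugeWt_le_one)
open Summit.QuantumFields.BalabanUV.Beta.GAN24.BorderGaugeLegContact (tsum_vhSAt_mul_dz)
open Summit.QuantumFields.BalabanUV.Beta.GAN24.GaugeReadChargeDipole (summable_shifted_majorant)

namespace Summit.QuantumFields.BalabanUV.Beta.GAN24.CombSlotDerivativeBorderRead

variable {d Lc : ℕ} [NeZero Lc]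

/-! ## §1 The `(inr, inl)` blocks of the rooted tables: only the VH border survives -/

/-- [folklore] **THE MULTIPLIER-ROW ∕ FIELD-COLUMN BLOCK OF THE UNFOLDED FIRST-ORDER FIELD TABLE IS THE WEIGHTED VH BORDER**: at level `0` the Wilson piece `wilsonA` is
field–field, at level `j+1` the value-function third jet `e3OfK = −mmRead (…)` is field–field; in both cases
`S_j κ′ u′ p x (inr μ) (inl κ₂) = (cVH·wVH d Lc j)·vhSAt ρ κ′ u′ p x (inr μ) (inl κ₂)` (`wVH d Lc 0 = 1`). -/
theorem SpureRecAt_inr_inl (ρ : Fin (d + 1) → ℤ) (cE cVH cΛ : ℝ) :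
    ∀ (j : ℕ) (κ' : Fin (d + 1)) (u' p x : Fin (d + 1) → ℤ) (μ κ₂ : Fin (d + 1)),
      SpureRecAt d Lc ρ cE cVH cΛ j κ' u' p x (Sum.inr μ) (Sum.inl κ₂) = (cVH * wVH d Lc j) * vhSAt ρ d Lc rfl κ' u' p x (Sum.inr μ) (Sum.inl κ₂)
  | 0, κ', u', p, x, μ, κ₂ => by
    rw [SpureRecAt_zero_level]
    simp only [Pi.add_apply, Pi.smul_apply, smul_eq_mul, wVH, pow_zero, one_pow, mul_one]
    have h0 : wilsonA d κ' u' p x (Sum.inr μ) (Sum.inl κ₂) = 0 := rfl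
    rw [h0, mul_zero, zero_add]
  | j + 1, κ', u', p, x, μ, κ₂ => by
    rw [SpureRecAt_succ]
    have h0 : ∀ F : MKer (d + 1) (Fib d), mmRead Lc F p x (Sum.inr μ) (Sum.inl κ₂) = 0 := fun F => rfl
    simp only [Pi.add_apply, Pi.smul_apply, smul_eq_mul, e3OfK_apply, h0, neg_zero, mul_zero, zero_add]

omit [NeZero Lc] in
/-- [folklore] The rooted first multiplier table has NO multiplier rows (`hessFFAt` is field–field). -/
theorem M1At_inr (ρ : Fin (d + 1) → ℤ) (cΛ : ℝ) (j : ℕ) (ρ' : Fin (d + 1)) (w p x : Fin (d + 1) → ℤ) (μ : Fin (d + 1)) (b : Fib d) :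
    M1At d Lc ρ cΛ j ρ' w p x (Sum.inr μ) b = 0 := by
  simp only [M1At, Pi.smul_apply, smul_eq_mul, hessFFAt_inr, mul_zero]

/-! ## §2 The `(inr, inl)` block of the slot derivative -/

/-- NOT IN PRINT; OUR BOOKKEEPING.  **THE MULTIPLIER-ROW ∕ FIELD-COLUMN BLOCK OF THE SLOT DERIVATIVE IS THE `ℋ`-COLUMN-WEIGHTED VH BORDER**: for ANY kernel `K`, blocking `Lc`,
tables `S_j = SpureRecAt …`, `M1_j = M1At …` and slot `(ν, y′)`,
`(dM K Lc S_j M1_j ν y′) p x (inr μ) (inl κ₂) = (cVH·wVH d Lc j)·Σ_κ′ Σ'_u′ colH K Lc ν y′ κ′ u′·vhSAt ρ κ′ u′ p x (inr μ) (inl κ₂)` — the multiplier vertex `vertexOfM` contributes nothing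
(`M1At_inr`), the field vertex `vertexOfK` only its VH border (`SpureRecAt_inr_inl`). -/
theorem dM_inr_inl (K : MKer (d + 1) (Fib d)) (ρ : Fin (d + 1) → ℤ) (cE cVH cΛ : ℝ) (j : ℕ) (ν : Fin (d + 1)) (y' : Fin (d + 1) → ℤ)
    (p x : Fin (d + 1) → ℤ) (μ κ₂ : Fin (d + 1)) :
    dM K Lc (SpureRecAt d Lc ρ cE cVH cΛ j) (M1At d Lc ρ cΛ j) ν y' p x (Sum.inr μ) (Sum.inl κ₂)
      = (cVH * wVH d Lc j) * ∑ κ', ∑' u', colH K Lc ν y' κ' u' * vhSAt ρ d Lc rfl κ' u' p x (Sum.inr μ) (Sum.inl κ₂) := by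
  simp only [dM, Pi.add_apply, vertexOfK, vertexOfM, wsum, cwsum_apply, SpureRecAt_inr_inl, M1At_inr, mul_zero, tsum_zero,
    Finset.sum_const_zero, add_zero]
  rw [Finset.mul_sum]
  refine Finset.sum_congr rfl fun κ' _ => ?_
  rw [← tsum_mul_left]
  exact tsum_congr fun u' => by ring

/-! ## §3 The pairing with the block pure gauge `ĝ_y` -/

/-- [folklore] The block pure gauge weight is the exterior derivative of the block indicator: `gaugeWt Lc y κ x = dz 1_{B(y)} κ x` (node-2 `dz`, an1's `b6UnitVec_eq`). -/
theorem gaugeWt_eq_dz (Lc : ℕ) (y : Fin (d + 1) → ℤ) (κ : Fin (d + 1)) (x : Fin (d + 1) → ℤ) :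
    gaugeWt Lc y κ x = dz (fun z => if blk Lc z = y then (1 : ℝ) else 0) κ x := by
  simp only [gaugeWt, dz, b6UnitVec_eq]

/-- [folklore] **FUBINI FOR A DECAYING WEIGHT AGAINST A FAMILY LOCALISED AT ITS INDEX, READ BY A BOUNDED TEST FORM**: for `|w u| ≤ Cw·e^{−δw‖u − q‖₁}` (`δw > 0`),
`|T u x κ| ≤ CT·e^{−δT‖x − u‖₁}` (`δT > 0`) and `|g κ x| ≤ 1`,
`Σ'_x Σ_κ (Σ'_u w u·T u x κ)·g κ x = Σ'_u w u·(Σ'_x Σ_κ T u x κ·g κ x)` (the family `(u, x) ↦ Σ_κ w u·T u x κ·g κ x` is dominated by leaf-06's shifted product majorant). -/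
theorem tsum_sum_tsum_mul_mul_eq {w : Site (d + 1) → ℝ} {T : Site (d + 1) → Site (d + 1) → Fin (d + 1) → ℝ} {g : Fin (d + 1) → Site (d + 1) → ℝ}
    {Cw δw CT δT : ℝ} {q : Site (d + 1)} (hw : ∀ u, |w u| ≤ Cw * Real.exp (-δw * l1 (u - q))) (hδw : 0 < δw)
    (hT : ∀ u x κ, |T u x κ| ≤ CT * Real.exp (-δT * l1 (x - u))) (hδT : 0 < δT) (hg : ∀ κ x, |g κ x| ≤ 1) :
    ∑' x, ∑ κ, (∑' u, w u * T u x κ) * g κ x = ∑' u, w u * ∑' x, ∑ κ, T u x κ * g κ x := by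
  have hCw : 0 ≤ Cw := le_trans (abs_nonneg _) (le_trans (hw q) (by rw [sub_self]; simp [B12Sec2to5.l1]))
  have hCT : 0 ≤ CT := le_trans (abs_nonneg _) (le_trans (hT q q 0) (by rw [sub_self]; simp [B12Sec2to5.l1]))
  -- the dominated family on `Site × Site`, indexed `(u, x)`
  have hmaj := summable_shifted_majorant (d := d) hδw hδT (((d + 1 : ℕ) : ℝ) * (Cw * CT)) q (fun u => u)
  have hF : Summable (Function.uncurry fun (u x : Site (d + 1)) => ∑ κ, w u * T u x κ * g κ x) := by
    refine Summable.of_norm_bounded hmaj (fun ux => ?_)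
    rw [Real.norm_eq_abs]
    show |∑ κ, w ux.1 * T ux.1 ux.2 κ * g κ ux.2| ≤ _
    calc |∑ κ, w ux.1 * T ux.1 ux.2 κ * g κ ux.2| ≤ ∑ κ, |w ux.1 * T ux.1 ux.2 κ * g κ ux.2| := Finset.abs_sum_le_sum_abs _ _
      _ ≤ ∑ _κ : Fin (d + 1), (Cw * CT) * (Real.exp (-δw * l1 (ux.1 - q)) * Real.exp (-δT * l1 (ux.2 - ux.1))) :=
          Finset.sum_le_sum fun κ _ => by
            rw [abs_mul, abs_mul]
            have h1 := hw ux.1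
            have h2 := hT ux.1 ux.2 κ
            have h3 := hg κ ux.2
            have h12 : |w ux.1| * |T ux.1 ux.2 κ| ≤ (Cw * Real.exp (-δw * l1 (ux.1 - q))) * (CT * Real.exp (-δT * l1 (ux.2 - ux.1))) :=
              mul_le_mul h1 h2 (abs_nonneg _) ((abs_nonneg _).trans h1)
            calc |w ux.1| * |T ux.1 ux.2 κ| * |g κ ux.2| ≤ (Cw * Real.exp (-δw * l1 (ux.1 - q))) * (CT * Real.exp (-δT * l1 (ux.2 - ux.1))) * 1 :=
                  mul_le_mul h12 h3 (abs_nonneg _) (by positivity)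
              _ = (Cw * CT) * (Real.exp (-δw * l1 (ux.1 - q)) * Real.exp (-δT * l1 (ux.2 - ux.1))) := by ring
      _ = ((d + 1 : ℕ) : ℝ) * (Cw * CT) * (Real.exp (-δw * l1 (ux.1 - q)) * Real.exp (-δT * l1 (ux.2 - ux.1))) := by
          rw [Finset.sum_const, Finset.card_univ, Fintype.card_fin, nsmul_eq_mul]; ring
  -- per-`κ` summability in `u` of `w u·T u x κ` (decaying weight × bounded entries)
  have hcol : ∀ (x : Site (d + 1)) (κ : Fin (d + 1)), Summable fun u => w u * T u x κ := fun x κ => by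
    refine Summable.of_norm_bounded (((summable_exp_shift' hδw q).mul_left Cw).mul_right CT) (fun u => ?_)
    rw [Real.norm_eq_abs, abs_mul]
    have h2 : |T u x κ| ≤ CT := le_trans (hT u x κ) (by
      have : Real.exp (-δT * l1 (x - u)) ≤ 1 := Real.exp_le_one_iff.mpr (by nlinarith [l1_nonneg (x - u)])
      nlinarith)
    exact mul_le_mul (hw u) h2 (abs_nonneg _) (by positivity)
  -- LHS = Σ'_x Σ'_u F (u, x)
  have e1 : ∀ x : Site (d + 1), ∑ κ, (∑' u, w u * T u x κ) * g κ x = ∑' u, ∑ κ, w u * T u x κ * g κ x := fun x => by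
    rw [Summable.tsum_finsetSum (fun κ _ => (hcol x κ).mul_right (g κ x))]
    exact Finset.sum_congr rfl fun κ _ => by rw [← tsum_mul_right]
  rw [tsum_congr e1, hF.tsum_comm]
  refine tsum_congr fun u => ?_
  rw [← tsum_mul_left]
  refine tsum_congr fun x => ?_
  rw [Finset.mul_sum]
  exact Finset.sum_congr rfl fun κ _ => by ring

/-- NOT IN PRINT; OUR BOOKKEEPING.  **THE `ĝ_y`-PAIRING OF THE MULTIPLIER-ROW ∕ FIELD-COLUMN BLOCK OF THE SLOT DERIVATIVE IS leaf-02's BORDER `dψ`-LAW AT `ψ = 1_{B(y)}`**: for a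
DECAYING kernel `K` (`Decays K CK δK`, `δK > 0`), `Lc ≥ 1`, an in-block root `ρ = toSite r`, every level `j`, slot `(ν, y′)`, label `y` and multiplier leg `(μ, p)`,
`Σ'_x Σ_κ₂ (dM K Lc S_j M1_j ν y′) p x (inr μ) (inl κ₂)·gaugeWt Lc y κ₂ x
   = (cVH·wVH d Lc j)·Σ_κ′ Σ'_u′ colH K Lc ν y′ κ′ u′·((1_{B(y)}(u′ + e_κ′) − 1_{B(y)}(p + ρ + Lc·e_μ))·linSymAt ρ Lc p u′ (inr μ) (inl κ′))`
— §2, one Fubini (`colH` decays from `Lc•y′` by `abs_colH_le`; the border entries are bounded by an1's `locStencil_vhSAt` at rate `1`; `|ĝ_y| ≤ 1`), then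
`BorderGaugeLegContact.tsum_vhSAt_mul_dz` with `ψ = 1_{B(y)}` termwise.  On the packer's support `p = Lc•w` the bracket reads `𝟙[blk Lc (u′ + e_κ′) = y] − 𝟙[w + e_μ = y]`. -/
theorem tsum_dM_inr_inl_mul_gaugeWt (hLc : 1 ≤ Lc) {r : Fin (d + 1) → ℕ} (hr : r ∈ box (d + 1) Lc) {K : MKer (d + 1) (Fib d)} {CK δK : ℝ} (hK : Decays K CK δK)
    (hδK : 0 < δK) (cE cVH cΛ : ℝ) (j : ℕ) (ν : Fin (d + 1)) (y' y : Fin (d + 1) → ℤ) (p : Fin (d + 1) → ℤ) (μ : Fin (d + 1)) :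
    ∑' x, ∑ κ₂, dM K Lc (SpureRecAt d Lc (toSite r) cE cVH cΛ j) (M1At d Lc (toSite r) cΛ j) ν y' p x (Sum.inr μ) (Sum.inl κ₂) * gaugeWt Lc y κ₂ x
      = (cVH * wVH d Lc j) * ∑ κ', ∑' u', colH K Lc ν y' κ' u'
          * (((if blk Lc (u' + AffineAveraging.unitVec κ') = y then (1 : ℝ) else 0)
              - (if blk Lc (p + toSite r + (Lc : ℤ) • AffineAveraging.unitVec μ) = y then (1 : ℝ) else 0))
            * linSymAt (toSite r) Lc p u' (Sum.inr μ) (Sum.inl κ')) := by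
  -- the border entries are bounded, uniformly, with decay in the field leg from the background bond
  have hV := locStencil_vhSAt (d := d) hLc hr (le_of_lt one_pos)
  set CV : ℝ := 3 * (AveragingHessianKernels.ell (d + 1) Lc : ℝ) ^ 2 * Real.exp (4 * ((d : ℝ) + 1) * Lc * 1) with hCV
  have hT : ∀ (κ' : Fin (d + 1)) (u x : Site (d + 1)) (κ₂ : Fin (d + 1)),
      |vhSAt (toSite r) d Lc rfl κ' u p x (Sum.inr μ) (Sum.inl κ₂)| ≤ CV * Real.exp (-1 * l1 (x - u)) := fun κ' u x κ₂ => by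
    have h := hV κ' u p x (Sum.inr μ) (Sum.inl κ₂)
    have hCV0 : 0 ≤ CV := (hV κ' u).nonneg (Sum.inl κ₂)
    refine h.trans (mul_le_mul_of_nonneg_left ?_ hCV0)
    rw [Real.exp_le_exp]
    nlinarith [l1_nonneg (p - u), l1_nonneg (x - u)]
  -- §2 termwise, then the weight pulled out
  have e1 : ∀ x : Site (d + 1), ∑ κ₂, dM K Lc (SpureRecAt d Lc (toSite r) cE cVH cΛ j) (M1At d Lc (toSite r) cΛ j) ν y' p x (Sum.inr μ) (Sum.inl κ₂) * gaugeWt Lc y κ₂ x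
      = (cVH * wVH d Lc j) * ∑ κ', (∑ κ₂, (∑' u', colH K Lc ν y' κ' u' * vhSAt (toSite r) d Lc rfl κ' u' p x (Sum.inr μ) (Sum.inl κ₂)) * gaugeWt Lc y κ₂ x) := fun x => by
    have h1 : ∀ κ₂ : Fin (d + 1), dM K Lc (SpureRecAt d Lc (toSite r) cE cVH cΛ j) (M1At d Lc (toSite r) cΛ j) ν y' p x (Sum.inr μ) (Sum.inl κ₂) * gaugeWt Lc y κ₂ x
        = (cVH * wVH d Lc j) * ∑ κ', (∑' u', colH K Lc ν y' κ' u' * vhSAt (toSite r) d Lc rfl κ' u' p x (Sum.inr μ) (Sum.inl κ₂)) * gaugeWt Lc y κ₂ x := fun κ₂ => by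
      rw [dM_inr_inl, ← Finset.sum_mul]; ring
    rw [Finset.sum_congr rfl (fun κ₂ _ => h1 κ₂), ← Finset.mul_sum, Finset.sum_comm]
  -- summability of each `κ′`-piece in `x` (so the finite `κ′`-sum and the constant leave the `x`-sum)
  have hpiece : ∀ κ' : Fin (d + 1), ∑' x, ∑ κ₂, (∑' u', colH K Lc ν y' κ' u' * vhSAt (toSite r) d Lc rfl κ' u' p x (Sum.inr μ) (Sum.inl κ₂)) * gaugeWt Lc y κ₂ x
      = ∑' u', colH K Lc ν y' κ' u' * ∑' x, ∑ κ₂, vhSAt (toSite r) d Lc rfl κ' u' p x (Sum.inr μ) (Sum.inl κ₂) * gaugeWt Lc y κ₂ x := fun κ' =>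
    tsum_sum_tsum_mul_mul_eq (T := fun u x κ₂ => vhSAt (toSite r) d Lc rfl κ' u p x (Sum.inr μ) (Sum.inl κ₂))
      (fun u => abs_colH_le (N := Lc) hK ν y' κ' u) hδK (fun u x κ₂ => hT κ' u x κ₂) one_pos (fun κ x => abs_gaugeWt_le_one Lc y κ x)
  have hsum : ∀ κ' : Fin (d + 1), Summable fun x => ∑ κ₂, (∑' u', colH K Lc ν y' κ' u' * vhSAt (toSite r) d Lc rfl κ' u' p x (Sum.inr μ) (Sum.inl κ₂)) * gaugeWt Lc y κ₂ x := by
    intro κ'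
    -- dominated by the `x`-marginal of the same product majorant
    have hCK : 0 ≤ CK := hK.nonneg (Sum.inl 0)
    have hCV0 : 0 ≤ CV := (hV κ' 0).nonneg (Sum.inl 0)
    have hmaj := summable_shifted_majorant (d := d) hδK one_pos (((d + 1 : ℕ) : ℝ) * (CK * CV)) ((Lc : ℤ) • y') (fun u => u)
    have hF : Summable (Function.uncurry fun (u x : Site (d + 1)) => ∑ κ₂, colH K Lc ν y' κ' u * vhSAt (toSite r) d Lc rfl κ' u p x (Sum.inr μ) (Sum.inl κ₂) * gaugeWt Lc y κ₂ x) := by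
      refine Summable.of_norm_bounded hmaj (fun ux => ?_)
      rw [Real.norm_eq_abs]
      show |∑ κ₂, colH K Lc ν y' κ' ux.1 * vhSAt (toSite r) d Lc rfl κ' ux.1 p ux.2 (Sum.inr μ) (Sum.inl κ₂) * gaugeWt Lc y κ₂ ux.2| ≤ _
      calc |∑ κ₂, colH K Lc ν y' κ' ux.1 * vhSAt (toSite r) d Lc rfl κ' ux.1 p ux.2 (Sum.inr μ) (Sum.inl κ₂) * gaugeWt Lc y κ₂ ux.2|
          ≤ ∑ κ₂, |colH K Lc ν y' κ' ux.1 * vhSAt (toSite r) d Lc rfl κ' ux.1 p ux.2 (Sum.inr μ) (Sum.inl κ₂) * gaugeWt Lc y κ₂ ux.2| := Finset.abs_sum_le_sum_abs _ _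
        _ ≤ ∑ _κ₂ : Fin (d + 1), (CK * CV) * (Real.exp (-δK * l1 (ux.1 - (Lc : ℤ) • y')) * Real.exp (-1 * l1 (ux.2 - ux.1))) :=
            Finset.sum_le_sum fun κ₂ _ => by
              rw [abs_mul, abs_mul]
              have h1 := abs_colH_le (N := Lc) hK ν y' κ' ux.1
              have h2 := hT κ' ux.1 ux.2 κ₂
              have h3 := abs_gaugeWt_le_one Lc y κ₂ ux.2
              have h12 : |colH K Lc ν y' κ' ux.1| * |vhSAt (toSite r) d Lc rfl κ' ux.1 p ux.2 (Sum.inr μ) (Sum.inl κ₂)|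
                  ≤ (CK * Real.exp (-δK * l1 (ux.1 - (Lc : ℤ) • y'))) * (CV * Real.exp (-1 * l1 (ux.2 - ux.1))) :=
                mul_le_mul h1 h2 (abs_nonneg _) ((abs_nonneg _).trans h1)
              calc |colH K Lc ν y' κ' ux.1| * |vhSAt (toSite r) d Lc rfl κ' ux.1 p ux.2 (Sum.inr μ) (Sum.inl κ₂)| * |gaugeWt Lc y κ₂ ux.2|
                  ≤ (CK * Real.exp (-δK * l1 (ux.1 - (Lc : ℤ) • y'))) * (CV * Real.exp (-1 * l1 (ux.2 - ux.1))) * 1 :=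
                    mul_le_mul h12 h3 (abs_nonneg _) (by positivity)
                _ = (CK * CV) * (Real.exp (-δK * l1 (ux.1 - (Lc : ℤ) • y')) * Real.exp (-1 * l1 (ux.2 - ux.1))) := by ring
        _ = ((d + 1 : ℕ) : ℝ) * (CK * CV) * (Real.exp (-δK * l1 (ux.1 - (Lc : ℤ) • y')) * Real.exp (-1 * l1 (ux.2 - ux.1))) := by
            rw [Finset.sum_const, Finset.card_univ, Fintype.card_fin, nsmul_eq_mul]; ring
    have hcol : ∀ (x : Site (d + 1)) (κ₂ : Fin (d + 1)), Summable fun u => colH K Lc ν y' κ' u * vhSAt (toSite r) d Lc rfl κ' u p x (Sum.inr μ) (Sum.inl κ₂) :=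
      fun x κ₂ => by
        refine Summable.of_norm_bounded (((summable_exp_shift' hδK ((Lc : ℤ) • y')).mul_left CK).mul_right CV) (fun u => ?_)
        rw [Real.norm_eq_abs, abs_mul]
        have h2 : |vhSAt (toSite r) d Lc rfl κ' u p x (Sum.inr μ) (Sum.inl κ₂)| ≤ CV := le_trans (hT κ' u x κ₂) (by
          have : Real.exp (-1 * l1 (x - u)) ≤ 1 := Real.exp_le_one_iff.mpr (by nlinarith [l1_nonneg (x - u)])
          nlinarith)
        exact mul_le_mul (abs_colH_le (N := Lc) hK ν y' κ' u) h2 (abs_nonneg _) (by positivity)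
    have e : (fun x => ∑ κ₂, (∑' u', colH K Lc ν y' κ' u' * vhSAt (toSite r) d Lc rfl κ' u' p x (Sum.inr μ) (Sum.inl κ₂)) * gaugeWt Lc y κ₂ x)
        = fun x => ∑' u, ∑ κ₂, colH K Lc ν y' κ' u * vhSAt (toSite r) d Lc rfl κ' u p x (Sum.inr μ) (Sum.inl κ₂) * gaugeWt Lc y κ₂ x := by
      funext x
      rw [Summable.tsum_finsetSum (fun κ₂ _ => (hcol x κ₂).mul_right (gaugeWt Lc y κ₂ x))]
      exact Finset.sum_congr rfl fun κ₂ _ => by rw [← tsum_mul_right]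
    rw [e]
    exact hF.prod_symm.prod
  rw [tsum_congr e1, tsum_mul_left, Summable.tsum_finsetSum (fun κ' _ => hsum κ')]
  congr 1
  refine Finset.sum_congr rfl fun κ' _ => ?_
  rw [hpiece κ']
  refine tsum_congr fun u' => ?_
  congr 1
  -- leaf-02's border `dψ`-law at `ψ = 1_{B(y)}`
  have eψ : ∀ x : Site (d + 1), ∑ κ₂, vhSAt (toSite r) d Lc rfl κ' u' p x (Sum.inr μ) (Sum.inl κ₂) * gaugeWt Lc y κ₂ x
      = ∑ κ₂, vhSAt (toSite r) d Lc rfl κ' u' p x (Sum.inr μ) (Sum.inl κ₂) * dz (fun z => if blk Lc z = y then (1 : ℝ) else 0) κ₂ x := fun x =>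
    Finset.sum_congr rfl fun κ₂ _ => by rw [gaugeWt_eq_dz]
  rw [tsum_congr eψ, tsum_vhSAt_mul_dz hLc hr κ' u' p μ (fun z => if blk Lc z = y then (1 : ℝ) else 0)]

/-! ## §4 Bookkeeping bricks for the (T-F) assembly (consumer: `WardResidualFieldTotals`) -/

/-- [folklore] **THE COLUMN SUMS OF A DECAYING KERNEL ARE BOUNDED**: `|Σ'_u K u p a c| ≤ CK·Zl(δK)`. -/
theorem abs_tsum_apply_le {K : MKer (d + 1) (Fib d)} {CK δK : ℝ} (hK : Decays K CK δK) (hδK : 0 < δK) (p : Site (d + 1)) (a c : Fib d) :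
    |∑' u, K u p a c| ≤ CK * Zl (d + 1) δK := by
  have hs : HasSum (fun u : Site (d + 1) => CK * Real.exp (-δK * l1 (u - p))) (CK * Zl (d + 1) δK) := by
    have h := (summable_exp_shift' hδK p).hasSum
    rw [tsum_exp_shift' p] at h
    exact h.mul_left CK
  rw [← Real.norm_eq_abs]
  exact tsum_of_norm_bounded hs fun u => by rw [Real.norm_eq_abs]; exact hK u p a c

/-- [folklore] **FUBINI FOR BOUNDED ROW WEIGHTS AGAINST A BI-LOCALISED KERNEL READ BY A BOUNDED TEST FORM**: for `|R μ p| ≤ CR`, `|D p x μ κ₂| ≤ CD·e^{−δ(‖p − c₁‖₁ + ‖x − c₂‖₁)}` (`δ > 0`)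
and `|g κ₂ x| ≤ 1`, `Σ'_x Σ_κ₂ (Σ'_p Σ_μ R μ p·D p x μ κ₂)·g κ₂ x = Σ'_p Σ_μ R μ p·(Σ'_x Σ_κ₂ D p x μ κ₂·g κ₂ x)`. -/
theorem tsum_sum_tsum_sum_mul_mul_eq {R : Fin (d + 1) → Site (d + 1) → ℝ} {D : Site (d + 1) → Site (d + 1) → Fin (d + 1) → Fin (d + 1) → ℝ}
    {g : Fin (d + 1) → Site (d + 1) → ℝ} {CR CD δ : ℝ} {c₁ c₂ : Site (d + 1)} (hR : ∀ μ p, |R μ p| ≤ CR)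
    (hD : ∀ p x μ κ₂, |D p x μ κ₂| ≤ CD * Real.exp (-δ * (l1 (p - c₁) + l1 (x - c₂)))) (hδ : 0 < δ) (hg : ∀ κ₂ x, |g κ₂ x| ≤ 1) :
    ∑' x, ∑ κ₂, (∑' p, ∑ μ, R μ p * D p x μ κ₂) * g κ₂ x = ∑' p, ∑ μ, R μ p * ∑' x, ∑ κ₂, D p x μ κ₂ * g κ₂ x := by
  have hCR : 0 ≤ CR := (abs_nonneg _).trans (hR 0 c₁)
  have hCD : 0 ≤ CD := by
    have h := hD c₁ c₂ 0 0
    rw [sub_self, sub_self] at h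
    have h0 : l1 (0 : Site (d + 1)) = 0 := by simp [B12Sec2to5.l1]
    rw [h0, add_zero, mul_zero, Real.exp_zero, mul_one] at h
    exact (abs_nonneg _).trans h
  -- the dominated family on `Site × Site`, indexed `(p, x)`: a product majorant
  have h1 : Summable fun p : Site (d + 1) => Real.exp (-δ * l1 (p - c₁)) := summable_exp_shift' hδ c₁
  have h2 : Summable fun x : Site (d + 1) => Real.exp (-δ * l1 (x - c₂)) := summable_exp_shift' hδ c₂
  have hmaj : Summable fun px : Site (d + 1) × Site (d + 1) =>
      (((d + 1 : ℕ) : ℝ) * ((d + 1 : ℕ) : ℝ) * (CR * CD)) * (Real.exp (-δ * l1 (px.1 - c₁)) * Real.exp (-δ * l1 (px.2 - c₂))) :=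
    (h1.mul_of_nonneg h2 (fun _ => (Real.exp_pos _).le) (fun _ => (Real.exp_pos _).le)).mul_left _
  have hterm : ∀ (p x : Site (d + 1)) (μ κ₂ : Fin (d + 1)), |R μ p * D p x μ κ₂ * g κ₂ x| ≤ (CR * CD) * (Real.exp (-δ * l1 (p - c₁)) * Real.exp (-δ * l1 (x - c₂))) :=
    fun p x μ κ₂ => by
      rw [abs_mul, abs_mul]
      have hA := hR μ p
      have hB := hD p x μ κ₂
      have hC := hg κ₂ x
      rw [mul_add, Real.exp_add] at hB
      have hAB : |R μ p| * |D p x μ κ₂| ≤ CR * (CD * (Real.exp (-δ * l1 (p - c₁)) * Real.exp (-δ * l1 (x - c₂)))) :=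
        mul_le_mul hA hB (abs_nonneg _) hCR
      calc |R μ p| * |D p x μ κ₂| * |g κ₂ x| ≤ CR * (CD * (Real.exp (-δ * l1 (p - c₁)) * Real.exp (-δ * l1 (x - c₂)))) * 1 :=
            mul_le_mul hAB hC (abs_nonneg _) (by positivity)
        _ = (CR * CD) * (Real.exp (-δ * l1 (p - c₁)) * Real.exp (-δ * l1 (x - c₂))) := by ring
  have hF : Summable (Function.uncurry fun (p x : Site (d + 1)) => ∑ μ, ∑ κ₂, R μ p * D p x μ κ₂ * g κ₂ x) := by
    refine Summable.of_norm_bounded hmaj (fun px => ?_)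
    rw [Real.norm_eq_abs]
    show |∑ μ, ∑ κ₂, R μ px.1 * D px.1 px.2 μ κ₂ * g κ₂ px.2| ≤ _
    calc |∑ μ, ∑ κ₂, R μ px.1 * D px.1 px.2 μ κ₂ * g κ₂ px.2| ≤ ∑ μ, |∑ κ₂, R μ px.1 * D px.1 px.2 μ κ₂ * g κ₂ px.2| := Finset.abs_sum_le_sum_abs _ _
      _ ≤ ∑ μ, ∑ κ₂, |R μ px.1 * D px.1 px.2 μ κ₂ * g κ₂ px.2| := Finset.sum_le_sum fun μ _ => Finset.abs_sum_le_sum_abs _ _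
      _ ≤ ∑ _μ : Fin (d + 1), ∑ _κ₂ : Fin (d + 1), (CR * CD) * (Real.exp (-δ * l1 (px.1 - c₁)) * Real.exp (-δ * l1 (px.2 - c₂))) :=
          Finset.sum_le_sum fun μ _ => Finset.sum_le_sum fun κ₂ _ => hterm px.1 px.2 μ κ₂
      _ = (((d + 1 : ℕ) : ℝ) * ((d + 1 : ℕ) : ℝ) * (CR * CD)) * (Real.exp (-δ * l1 (px.1 - c₁)) * Real.exp (-δ * l1 (px.2 - c₂))) := by
          rw [Finset.sum_const, Finset.sum_const, Finset.card_univ, Fintype.card_fin, nsmul_eq_mul, nsmul_eq_mul]; ring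
  -- per-`(μ, κ₂)` summability in `p` of `R μ p·D p x μ κ₂`
  have hcol : ∀ (x : Site (d + 1)) (μ κ₂ : Fin (d + 1)), Summable fun p => R μ p * D p x μ κ₂ := fun x μ κ₂ => by
    refine Summable.of_norm_bounded ((h1.mul_left (CR * CD)).mul_right (Real.exp (-δ * l1 (x - c₂)))) (fun p => ?_)
    rw [Real.norm_eq_abs, abs_mul]
    have hB := hD p x μ κ₂
    rw [mul_add, Real.exp_add] at hB
    calc |R μ p| * |D p x μ κ₂| ≤ CR * (CD * (Real.exp (-δ * l1 (p - c₁)) * Real.exp (-δ * l1 (x - c₂)))) := mul_le_mul (hR μ p) hB (abs_nonneg _) hCR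
      _ = CR * CD * Real.exp (-δ * l1 (p - c₁)) * Real.exp (-δ * l1 (x - c₂)) := by ring
  -- LHS = Σ'_x Σ'_p F (p, x)
  have e1 : ∀ x : Site (d + 1), ∑ κ₂, (∑' p, ∑ μ, R μ p * D p x μ κ₂) * g κ₂ x = ∑' p, ∑ μ, ∑ κ₂, R μ p * D p x μ κ₂ * g κ₂ x := fun x => by
    have e2 : ∀ κ₂ : Fin (d + 1), (∑' p, ∑ μ, R μ p * D p x μ κ₂) * g κ₂ x = ∑' p, ∑ μ, R μ p * D p x μ κ₂ * g κ₂ x := fun κ₂ => by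
      rw [← tsum_mul_right]
      exact tsum_congr fun p => by rw [Finset.sum_mul]
    rw [Finset.sum_congr rfl (fun κ₂ _ => e2 κ₂)]
    rw [← Summable.tsum_finsetSum (fun κ₂ _ => (summable_sum fun μ _ => hcol x μ κ₂).mul_right (g κ₂ x) |>.congr (fun p => by rw [Finset.sum_mul]))]
    exact tsum_congr fun p => Finset.sum_comm
  rw [tsum_congr e1, hF.tsum_comm]
  refine tsum_congr fun p => ?_
  -- each `(μ, κ₂)`-slice is summable in `x`
  have hrow : ∀ (μ κ₂ : Fin (d + 1)), Summable fun x => R μ p * D p x μ κ₂ * g κ₂ x := fun μ κ₂ => by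
    refine Summable.of_norm_bounded ((h2.mul_left ((CR * CD) * Real.exp (-δ * l1 (p - c₁))))) (fun x => ?_)
    rw [Real.norm_eq_abs]
    calc |R μ p * D p x μ κ₂ * g κ₂ x| ≤ (CR * CD) * (Real.exp (-δ * l1 (p - c₁)) * Real.exp (-δ * l1 (x - c₂))) := hterm p x μ κ₂
      _ = (CR * CD) * Real.exp (-δ * l1 (p - c₁)) * Real.exp (-δ * l1 (x - c₂)) := by ring
  rw [Summable.tsum_finsetSum (fun μ _ => summable_sum fun κ₂ _ => hrow μ κ₂)]
  refine Finset.sum_congr rfl fun μ _ => ?_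
  rw [← tsum_mul_left]
  refine tsum_congr fun x => ?_
  rw [Finset.mul_sum]
  exact Finset.sum_congr rfl fun κ₂ _ => by ring

omit [NeZero Lc] in
/-- [folklore] **A LATTICE SUM SUPPORTED ON THE COARSE POINTS IS A COARSE SUM**: if `f p = 0` whenever `off Lc p ≠ 0`, then `Σ'_p f p = Σ'_w f (Lc•w)`. -/
theorem tsum_coarse_of_off (hLc : 1 ≤ Lc) {f : Site (d + 1) → ℝ} (hf : ∀ p, off Lc p ≠ 0 → f p = 0) :
    ∑' p, f p = ∑' w : Site (d + 1), f ((Lc : ℤ) • w) := by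
  have hinj : Function.Injective (fun w : Site (d + 1) => (Lc : ℤ) • w) := fun w w' h => by
    have := congrArg (blk Lc) h
    simpa only [blk_zsmul hLc] using this
  rw [← hinj.tsum_eq (f := f)]
  intro p hp
  by_cases h0 : off Lc p = 0
  · exact ⟨blk Lc p, (eq_smul_blk_of_off_eq_zero hLc h0).symm⟩
  · exact absurd (hf p h0) hp

end Summit.QuantumFields.BalabanUV.Beta.GAN24.CombSlotDerivativeBorderRead

end
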